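import Summits.HodgeConjecture.HodgeConjecture.Theorems.CyclicUnitaryPowersFourFactsPL
import Literature.AlgebraicGeometry.HodgeTheory.UnitaryReflectionGroupZariskiDenseHolds

/-!
# Crux K1 `VeryGeneralDeckCommutatorsInHg` and the rung leaf modulo THREE cited facts, the Carlson–Toledo
# family being constructed and CT Thm. 7.1 being a theorem (route `CyclicUnitaryPowers`,
# items stmt-HodgeConjecture-19544 / 19543)

Prover seat `hodge-nonav-prover-Ax` (g5), cell `hodge-nonav`, 2026-08-28. Landed `--supports stmt-HodgeConjecture-19544`;
sorry-free, no definition, no new named fact. CONDITIONAL results; nothing here says HC ∕ HC_AV is proved; rung F-H1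
is not moved.

`CyclicUnitaryPowersFourFactsPL.veryGeneralDeckCommutatorsInHg_of_four_facts_PL` (g4) closes K1 from
{`carlsonToledo1999_cyclicReflectionSystem`, `Griffiths1969_residueKernel_eq_jacobianIdeal`,
`carlsonToledo1999_unitaryReflection_zariskiDense`, `cmsp_nonHodgeGenericPoints_countable_algebraic_cover`}; the
third of these — Carlson–Toledo's density theorem for unitary reflection groups (Duke 1999, §7 Thm. 7.1) — is the
tree THEOREM `carlsonToledo1999_unitaryReflection_zariskiDense_holds` (Literature
`HodgeTheory/UnitaryReflectionGroupZariskiDenseHolds`, seat `hodge-nonav-prover-Bx` g6). Hence the current floor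
of the crux:

* `veryGeneralDeckCommutatorsInHg_of_three_facts_PL` — **K1 ⟸ {`carlsonToledo1999_cyclicReflectionSystem`
  (CT §3, §6 Prop., §7 last ¶: the Picard–Lefschetz package of the family of cyclic covers, the family itself
  being constructed in `HodgeTheory/CyclicCoverUniversalFamily`), `Griffiths1969_residueKernel_eq_jacobianIdeal`
  (Griffiths 1969; Voisin II Thm. 6.10 / Cor. 6.12), `cmsp_nonHodgeGenericPoints_countable_algebraic_cover`
  (CMSP §15.3 with Cattani–Deligne–Kaplan 1995)}**;
* `cyclicSurfacePowersHodge_of_three_facts_PL` — the rung leaf `CyclicSurfacePowersHodge` likewise.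

Compared with `CyclicUnitaryPowersThreeFacts.veryGeneralDeckCommutatorsInHg_of_three_facts` (seat Bx g6), the
family fact `nonempty_carlsonToledoFamily` (family + package, bundled) is replaced by the strictly smaller
`carlsonToledo1999_cyclicReflectionSystem` (package only).

## References

* [CarlsonToledo1999] J. A. Carlson, D. Toledo, Discriminant complements and kernels of monodromy
  representations, Duke Math. J. 97 (1999), §2, §3, §6 Proposition, §7 (last paragraph and Thm. 7.1).
* [VoisinHodgeII2003] C. Voisin, Hodge Theory and Complex Algebraic Geometry II (2003), §6.1.3 Thm. 6.10 / Cor. 6.12.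
* [CattaniDeligneKaplan1995] E. Cattani, P. Deligne, A. Kaplan, On the locus of Hodge classes, J. Amer. Math.
  Soc. 8 (1995), Thm. 1.1, Cor. 1.2.
-/

noncomputable section

open Literature.AlgebraicGeometry.Motives Literature.AlgebraicGeometry.HodgeTheory

-- mandated namespace `Summit.HodgeConjecture.HodgeConjecture.Theorems` trips `linter.dupNamespace` (off tree-wide)
set_option linter.dupNamespace false

namespace Summit.HodgeConjecture.HodgeConjecture.Theorems.CyclicUnitaryPowersThreeFactsPL

/-- **Crux K1 `VeryGeneralDeckCommutatorsInHg` modulo THREE cited facts** — the Picard–Lefschetz package of the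
family of cyclic covers of the plane (`carlsonToledo1999_cyclicReflectionSystem`, CT §3, §6, §7; the family is
constructed), Griffiths' residue-kernel theorem (Voisin II Thm. 6.10) and the Cattani–Deligne–Kaplan cover of the
non-Hodge-generic points; Carlson–Toledo's density theorem (Thm. 7.1) enters as the tree theorem
`carlsonToledo1999_unitaryReflection_zariskiDense_holds`. CONDITIONAL; nothing here says HC ∕ HC_AV is proved.
[cite: CarlsonToledo1999, §2, §3, §6 Proposition, §7 last paragraph and Thm. 7.1]
[cite: VoisinHodgeII2003, §6.1.3 Thm. 6.10 and Cor. 6.12] -/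
theorem veryGeneralDeckCommutatorsInHg_of_three_facts_PL
    (hPL : carlsonToledo1999_cyclicReflectionSystem)
    (hG : Griffiths1969_residueKernel_eq_jacobianIdeal)
    (hCDK : cmsp_nonHodgeGenericPoints_countable_algebraic_cover) :
    Summit.HodgeConjecture.HodgeConjecture.Theses.CyclicUnitaryPowers.VeryGeneralDeckCommutatorsInHg :=
  CyclicUnitaryPowersFourFactsPL.veryGeneralDeckCommutatorsInHg_of_four_facts_PL
    @hPL @hG carlsonToledo1999_unitaryReflection_zariskiDense_holds @hCDK

/-- **The rung leaf `CyclicSurfacePowersHodge` modulo the same THREE cited facts** (family constructed, CT Thm. 7.1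
a tree theorem). CONDITIONAL; rung F-H1 not moved.
[cite: CarlsonToledo1999, §2, §3, §6 Proposition, §7 last paragraph and Thm. 7.1]
[cite: VoisinHodgeII2003, §6.1.3 Thm. 6.10 and Cor. 6.12] -/
theorem cyclicSurfacePowersHodge_of_three_facts_PL
    (hPL : carlsonToledo1999_cyclicReflectionSystem)
    (hG : Griffiths1969_residueKernel_eq_jacobianIdeal)
    (hCDK : cmsp_nonHodgeGenericPoints_countable_algebraic_cover) :
    Summit.HodgeConjecture.HodgeConjecture.Theses.CyclicUnitaryPowers.CyclicSurfacePowersHodge :=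
  CyclicUnitaryPowersFourFactsPL.cyclicSurfacePowersHodge_of_four_facts_PL
    @hPL @hG carlsonToledo1999_unitaryReflection_zariskiDense_holds @hCDK

end Summit.HodgeConjecture.HodgeConjecture.Theorems.CyclicUnitaryPowersThreeFactsPL

end
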